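import Mathlib
import Summits.MatrixMultiplication.MatrixMultiplication.Theses.ThinBlockAlpha
import Summits.MatrixMultiplication.MatrixMultiplication.Theses.EisensteinValCertificates
import Literature.Computability.AlgebraicComplexity.LocalStrongUSP

/-!
# Strategist gen-1 sketch — crux `ThinBlockAlpha.ThinPackings` (stmt-MatrixMultiplication-10595)

planner-cstrat-stmt-MatrixMultiplication-10595-p1-0, 2026-08-17.  Companion of `STRATEGY-CENSUS.md` (gen 1) and of
the line `Lines/cyclic_carry_charts.lean`.  Contents:

* §1 IN-LEAN CHECK of the carry lemma on the smallest case: CKSU Prop 28's two-block design `U₂ = {123, 231}`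
  re-hosted in the CYCLIC group `ℤ/7³ = ZMod 343` with margin digits `{3, 4}` is an STPP family (`native_decide`), while the
  full-digit version is not (brute force, `calc/margin_usp.py`; the failing triples are carry artefacts).
* §2 NORMAL FORMS (Strengthen S5 of the census): `PrimeCyclicThinPackings`, `IntegerThinPackings`; the cheap
  directions; the statement `CyclicNormalForm : ThinPackings → PrimeCyclicThinPackings` with its proof plan (slice-rank
  small-factor count as in `Theorems/FourierTwoFamiliesModPCyclicReduction.lean`) — which is why the cyclic/integer
  heart is the crux in costume and is NOT registered as a line.
* §3 NEGATION N6: the Val programme is dead — `PrattConj41Refuted : ¬ EisensteinValCertificates.PrimeValConjecture`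
  (statement + proof plan; the construction is the margin avatar of §1 tensor-powered, Bertrand, Pratt Prop 3.3 = tree
  `sum_card_mul_le_card_zeroSumTriples`).  Recommended to stmt-7789's refuters/provers (evidence attached there).
-/

set_option linter.dupNamespace false

namespace Summit.MatrixMultiplication.MatrixMultiplication.Cruxes.ThinPackings.StrategistP1

open Finset Literature.Computability.AlgebraicComplexity
open Summit.MatrixMultiplication.MatrixMultiplication.Theses.ThinBlockAlpha (ThinPackings)

/-! ## §1 The smallest cyclic avatar, kernel-checked

`U₂ = {123, 231}` (tree `uspRow2`-shape), base `q = 7`, margin digits `{3,4}`, host `ZMod 343`: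
block `123`: `A = {3,4}·7⁰`, `B = {3,4}·7¹`, `C = {3,4}·7²`; block `231`: `A = {3,4}·7²`, `B = {3,4}·7⁰`,
`C = {3,4}·7¹`. -/

/-- Legs of the two blocks (row `0 = 123`, row `1 = 231`) in `ZMod 343`. -/
def avA : Fin 2 → Finset (ZMod 343) := ![{3, 4}, {147, 196}]
/-- see `avA` -/
def avB : Fin 2 → Finset (ZMod 343) := ![{21, 28}, {3, 4}]
/-- see `avA` -/
def avC : Fin 2 → Finset (ZMod 343) := ![{147, 196}, {21, 28}]

set_option maxRecDepth 100000 in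
/-- The margin avatar of `U₂` in the cyclic group `ℤ/343` is an STPP family (`native_decide`, 8·2⁶ cases; kernel
`decide` exceeds `maxRecDepth` on the nested Finset quantifiers — a Theorems-grade proof goes through the carry lemma,
line stubs `stub_marginUSP` + `stub_carryCompiler`, not through evaluation). -/
theorem avatar_isSTPP : IsSTPP avA avB avC := by
  unfold IsSTPP
  native_decide

/-- Its total volume `Σ|A||B||C| = 16` (two blocks ⟨2,2,2⟩); tensor powers `U₂^{×t}` at base `q` give volume
`2^t (q−5)^{3t}` in `ℤ/q^{3t}`, which exceeds `(q^{3t})^{1+c}`, `c = (log 2 + 3 log(1−5/q))/(3 log q) > 0` for `q ≥ 25`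
(`c ≈ 0.039` at `q = 100`). -/
example : ∑ i, (avA i).card * (avB i).card * (avC i).card = 16 := by decide

/-! ## §2 Normal forms: WLOG the host is prime cyclic / the integers -/

/-- `ThinPackings` with PRIME CYCLIC hosts. -/
def PrimeCyclicThinPackings : Prop :=
  ∀ a : ℝ, 0 ≤ a → a < 1 → ∀ η : ℝ, 0 < η → ∃ p : ℕ, p.Prime ∧ ∃ (L N M : ℕ) (A B C : Fin L → Finset (ZMod p)),
    IsSTPP A B C ∧ (∀ i, (A i).card = N ∧ (B i).card = M ∧ (C i).card = N) ∧ 2 ≤ N ∧ (N : ℝ) ^ a ≤ M ∧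
    (p : ℝ) ≤ L * (N : ℝ) ^ (2 + η)

/-- `ThinPackings` over the INTEGERS (host-free: finite sets of integers in `[−b, b]`, STPP in `ℤ`, "host size"
`6b+1` = the modulus of the carry-free transport). -/
def IntegerThinPackings : Prop :=
  ∀ a : ℝ, 0 ≤ a → a < 1 → ∀ η : ℝ, 0 < η → ∃ (b L N M : ℕ) (A B C : Fin L → Finset ℤ),
    (∀ i, ∀ x ∈ A i ∪ B i ∪ C i, |x| ≤ b) ∧ IsSTPP A B C ∧
    (∀ i, (A i).card = N ∧ (B i).card = M ∧ (C i).card = N) ∧ 2 ≤ N ∧ (N : ℝ) ^ a ≤ M ∧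
    ((6 * b + 1 : ℕ) : ℝ) ≤ L * (N : ℝ) ^ (2 + η)

/-- The cheap direction: prime cyclic witnesses are witnesses. -/
theorem thinPackings_of_primeCyclic (h : PrimeCyclicThinPackings) : ThinPackings := by
  intro a ha0 ha1 η hη
  obtain ⟨p, hp, L, N, M, A, B, C, hS, hc, hN, hM, hH⟩ := h a ha0 ha1 η hη
  haveI : Fact p.Prime := ⟨hp⟩
  refine ⟨ZMod p, inferInstance, inferInstance, L, N, M, A, B, C, hS, hc, hN, hM, ?_⟩
  simpa [ZMod.card] using hH

/-- **Cyclic normal form** (to be landed as a Theorems file; NOT a line).  PROOF PLAN: given `(a, η)`, apply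
`ThinPackings` at `a' = 1 − θ`, `η' ≤ η/4` with `θ` small; decompose the witness host `H ≅ ∏ ℤ/m_t`; for each prime
power `q ≤ Λ` the tree's slice-rank bound `sum_card_div_le_of_addEquiv_piZMod` gives
`L·N·M/3 ≤ θ_q^{r_q}·|H| ≤ θ_q^{r_q}·L·N^{2+η'}`, i.e. `r_q·log(1/θ_q) ≤ (1 − a' + η')·log N + log 3`; factors `> Λ`
number `≤ log|H|/log Λ`; flatten by the carry-free mixed-radix map (radix `3m_t`, tree
`FourierTwoFamiliesModPCyclicReductionTransfer`) at cost `3^{#factors} ≤ N^{η/2}` once `Λ = exp(C/η)` and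
`θ ≤ η/(8 C' π(Λ))`; Bertrand prime in `(3R, 6R]`; the slack lands at `η' + η/2 + o(1) ≤ η` and `N^{a} ≤ N^{a'} ≤ M`.
Consequences: `PrimeCyclicThinPackings ↔ ThinPackings ↔ IntegerThinPackings` (lift `ℤ/p → [0,p)`); the crux — and its
negation stmt-0596 — are statements about finite sets of integers / `ℤ/p`. -/
def CyclicNormalForm : Prop := ThinPackings → PrimeCyclicThinPackings

/-! ## §3 Negation: Pratt's Conjecture 4.1 is false (the Val obstruction programme is dead)

CONSTRUCTION.  `U` a local strong USP of width `k` (e.g. `U₂^{×t}`, width `3t`, `2^t` rows), base `q ≥ 25`, margin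
digits `D = [3, q−3]`: the family `A_u = {Σ_j d_j q^j : d_j ∈ D if u_j = 1, else 0}` etc. is STPP in `ℤ/q^k`
(carry lemma = line stub `stub_marginUSP` + `stub_carryCompiler`; §1 is its smallest instance), indeed in `ℤ`
(a relation `= 0` in `ℤ` is `≡ 0 mod q^k`), hence in `ℤ/p` for every prime `p > 3q^k` (6-term sums of elements of
`[0, q^k)` have absolute value `< 3q^k`; Bertrand: `p ≤ 6q^k`).  Volume `Σ_u |A_u||B_u||C_u| = |U|·(q−5)^k`.  Pratt
Prop 3.3 (tree `sum_card_mul_le_card_zeroSumTriples` + `isEquilateralTrapezoidFree_of_addSimultaneousTPP`, the exact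
filter form of `PrimeValConjecture`) gives a trapezoid-free triple in `ℤ/p` with `≥ |U|(q−5)^k ≥ (p/6)^{1+c}·q^{-O(1)}`
solutions, `c = ((1/k)log|U| + log(1−5/q))/log q`: `U₂`-powers at `q = 100` give `c = 0.039`; so
`PrimeValConjecture` fails at every `ε < c` (take `t → ∞`).  Capacity-rate local strong USPs (`2^{2/3}`, CKSU Prop 18
+ Prop 34) give `c ≈ 0.09` (`q ≈ 60`).  Untouched: `PrimeValSaving` (3/2 − δ) and `PrimeFourThirdsSaving` (4/3 − δ):
re-hosted designs certifying `ω ≤ τ` give only `c = (1 − τ/3)·(log V^{1/k}/log q) < 1/3`. -/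
def PrattConj41Refuted : Prop :=
  ¬ Summit.MatrixMultiplication.MatrixMultiplication.Theses.EisensteinValCertificates.PrimeValConjecture

end Summit.MatrixMultiplication.MatrixMultiplication.Cruxes.ThinPackings.StrategistP1
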